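import Literature.NumberTheory.Transcendental.CurvePeriodsGmLoopsProofs
import HarnessLib

/-!
# Periods of curve type: homotopic paths give the same symbol (relation (R5), general form)

Companion of `Literature/NumberTheory/Transcendental/CurvePeriods.lean` (Huber–Wüstholz 2022,
Thm. 13.3 (2), rendered on explicit period symbols with the elementary relations (R1)–(R5)). The
rendering encodes the relations of relative singular homology by the single generator (R5),
boundaries of `C¹` triangles with algebraic vertices. The files `CurvePeriodsGmLoopsProofs.lean`,
`CurvePeriodsGmPathsProofs.lean`, `CurvePeriodsBakerProofs.lean` each cut a specific homotopy on
`𝔾ₘ` into two such triangles. This file isolates the general statement, for use on any curve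
(e.g. for the uniformisation of elliptic curves):

* `span_single_sub_single_of_homotopy` — if `H : [0,1]² → Z` is `C¹` on the closed square, fixes
  the two end points (`H(s, 0)`, `H(s, 1)` independent of `s`), and `γ₀ = H(0, ·)`, `γ₁ = H(1, ·)`
  on `[0,1]`, then `(Z, ω, γ₀) − (Z, ω, γ₁)` lies in the `ℚ̄`-span of the elementary relations, for
  every polynomial 1-form `ω` over `ℚ̄` (book §3.3.1: homotopic paths with end points in `D` define
  the same class in `H₁(C, D; ℤ)`). The square is cut along its diagonal into the `C¹` triangles
  `H(a + b, b)` and `H(a, a + b)`, whose third vertices are the (algebraic) end points;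
* `span_single_sub_single_of_loopHomotopy` — the same for a FREE homotopy of closed paths
  (`H(s, 0) = H(s, 1)`, base point `H(s, 0)` moving along a `C¹` path with algebraic end points):
  conjugate loops have the same symbol modulo relations (two triangles and the reversal relation
  `α + α⁻ ∼ 0` of `CurvePeriodsRelationsProofs.lean`).

## References

* A. Huber, G. Wüstholz, *Transcendence and Linear Relations of 1-Periods*, Cambridge Tracts in
  Mathematics 227, CUP 2022 [HuberWustholz2022], §3.3.1 (pp. 42–43 of the held text),
  Thm. 13.3 (2) (p. 121).
-/

noncomputable section

open scoped BigOperators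
open MvPolynomial Set

namespace Literature.NumberTheory.Transcendental

namespace CurvePeriods

set_option quotPrecheck false in
/-- Membership in the `ℚ̄`-span of the elementary relations, in the format of the conclusion of
`HuberWustholzCurvePeriods`. -/
local notation "InSpan" c:max => ∃ (k : ℕ) (ρ : Fin k → (PeriodSymbol →₀ ℂ)) (a : Fin k → ℂ),
  (∀ l, IsElementaryRelation (ρ l)) ∧ (∀ l, IsAlgebraic ℚ (a l)) ∧ c = ∑ l, a l • ρ l

/-- Points of the standard triangle, pushed by `(a, b) ↦ (a + b, b)`, land in the unit square.
[folklore] -/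
theorem add_mem_square_of_mem_stdTriangle {q : ℝ × ℝ} (hq : q ∈ stdTriangle) :
    (q.1 + q.2, q.2) ∈ Icc (0 : ℝ) 1 ×ˢ Icc (0 : ℝ) 1 :=
  ⟨⟨by linarith [hq.1, hq.2.1], hq.2.2⟩, ⟨hq.2.1, by linarith [hq.1, hq.2.2]⟩⟩

/-- Points of the standard triangle, pushed by `(a, b) ↦ (a, a + b)`, land in the unit square.
[folklore] -/
theorem mem_square_add_of_mem_stdTriangle {q : ℝ × ℝ} (hq : q ∈ stdTriangle) :
    (q.1, q.1 + q.2) ∈ Icc (0 : ℝ) 1 ×ˢ Icc (0 : ℝ) 1 :=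
  ⟨⟨hq.1, by linarith [hq.2.1, hq.2.2]⟩, ⟨by linarith [hq.1, hq.2.1], hq.2.2⟩⟩

/-- **Homotopic paths give the same period symbol, modulo the elementary relations.** Let
`H : ℝ² → ℂⁿ` be `C¹` on the closed unit square with values in `Z` there, constant on the bottom
and on the top edge (`H(s, 0) = H(0, 0)`, `H(s, 1) = H(0, 1)`), and let `γ₀`, `γ₁` be paths on `Z`
agreeing with `H(0, ·)`, `H(1, ·)` on `[0,1]`. Then `(Z, ω, γ₀) − (Z, ω, γ₁)` is a combination of
four elementary relations: the boundaries (R5) of the `C¹` triangles `H(a + b, b)`, `H(a, a + b)`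
and the two constant paths at the end points. [cite: HuberWustholz2022, §3.3.1 (pp. 42–43)] -/
theorem span_single_sub_single_of_homotopy {Z : CurveData} (hZ : Z.IsSmoothAffineCurve)
    (ω : Fin Z.n → MvPolynomial (Fin Z.n) ℂ) (h : ∀ i, HasAlgCoeffs (ω i))
    (H : ℝ × ℝ → (Fin Z.n → ℂ)) (hH : ContDiffOn ℝ 1 H (Icc (0 : ℝ) 1 ×ˢ Icc (0 : ℝ) 1))
    (hmem : ∀ q ∈ Icc (0 : ℝ) 1 ×ˢ Icc (0 : ℝ) 1, H q ∈ Z.points)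
    (h0 : ∀ s ∈ Icc (0 : ℝ) 1, H (s, 0) = H (0, 0)) (h1 : ∀ s ∈ Icc (0 : ℝ) 1, H (s, 1) = H (0, 1))
    (γ₀ γ₁ : CurvePath Z) (hγ₀ : ∀ t ∈ Icc (0 : ℝ) 1, γ₀.toFun t = H (0, t))
    (hγ₁ : ∀ t ∈ Icc (0 : ℝ) 1, γ₁.toFun t = H (1, t)) :
    InSpan (Finsupp.single (⟨Z, hZ, ω, h, γ₀⟩ : PeriodSymbol) (1 : ℂ) -
      Finsupp.single (⟨Z, hZ, ω, h, γ₁⟩ : PeriodSymbol) (1 : ℂ)) := by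
  have h0I : (0 : ℝ) ∈ Icc (0 : ℝ) 1 := ⟨le_rfl, zero_le_one⟩
  have h1I : (1 : ℝ) ∈ Icc (0 : ℝ) 1 := ⟨zero_le_one, le_rfl⟩
  have hP0 : H (0, 0) = γ₀.toFun 0 := (hγ₀ 0 h0I).symm
  have hP1 : H (0, 1) = γ₀.toFun 1 := (hγ₀ 1 h1I).symm
  -- the constant paths at the two end points and the diagonal of the homotopy
  let κ₀ : CurvePath Z :=
    { toFun := fun _ => γ₀.toFun 0
      contDiffOn := contDiffOn_const
      mem_points := fun _ _ => γ₀.mem_points 0 h0I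
      algebraic_zero := γ₀.algebraic_zero
      algebraic_one := γ₀.algebraic_zero }
  let κ₁ : CurvePath Z :=
    { toFun := fun _ => γ₀.toFun 1
      contDiffOn := contDiffOn_const
      mem_points := fun _ _ => γ₀.mem_points 1 h1I
      algebraic_zero := γ₀.algebraic_one
      algebraic_one := γ₀.algebraic_one }
  let δ : CurvePath Z :=
    { toFun := fun t => H (t, t)
      contDiffOn := hH.comp (contDiff_id.prodMk contDiff_id).contDiffOn fun t ht => mk_mem_prod ht ht
      mem_points := fun t ht => hmem _ (mk_mem_prod ht ht)
      algebraic_zero := fun i => by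
        show IsAlgebraic ℚ (H (0, 0) i)
        rw [hP0]
        exact γ₀.algebraic_zero i
      algebraic_one := fun i => by
        show IsAlgebraic ℚ (H (1, 1) i)
        rw [h1 1 h1I, hP1]
        exact γ₀.algebraic_one i }
  -- the two triangles cut from the square along the diagonal
  have hτ₁ : ContDiffOn ℝ 1 (fun q : ℝ × ℝ => H (q.1 + q.2, q.2)) stdTriangle :=
    hH.comp ((contDiff_fst.add contDiff_snd).prodMk contDiff_snd).contDiffOn
      fun q hq => add_mem_square_of_mem_stdTriangle hq
  have hτ₂ : ContDiffOn ℝ 1 (fun q : ℝ × ℝ => H (q.1, q.1 + q.2)) stdTriangle :=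
    hH.comp (contDiff_fst.prodMk (contDiff_fst.add contDiff_snd)).contDiffOn
      fun q hq => mem_square_add_of_mem_stdTriangle hq
  have hb₁ := IsElementaryRelation.boundary Z hZ ω h (fun q : ℝ × ℝ => H (q.1 + q.2, q.2)) hτ₁
    (fun q hq => hmem _ (add_mem_square_of_mem_stdTriangle hq)) κ₀ γ₁ δ
    (fun t ht => by show γ₀.toFun 0 = H (t + 0, 0); rw [add_zero, h0 t ht, hP0])
    (fun t ht => by show γ₁.toFun t = H (1 - t + t, t); rw [sub_add_cancel, hγ₁ t ht])
    (fun t _ => by show H (t, t) = H (0 + t, t); rw [zero_add])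
  have hb₂ := IsElementaryRelation.boundary Z hZ ω h (fun q : ℝ × ℝ => H (q.1, q.1 + q.2)) hτ₂
    (fun q hq => hmem _ (mem_square_add_of_mem_stdTriangle hq)) δ κ₁ γ₀
    (fun t _ => by show H (t, t) = H (t, t + 0); rw [add_zero])
    (fun t ht => by
      show γ₀.toFun 1 = H (1 - t, 1 - t + t)
      rw [sub_add_cancel, h1 (1 - t) ⟨by linarith [ht.2], by linarith [ht.1]⟩, hP1])
    (fun t ht => by show γ₀.toFun t = H (0, 0 + t); rw [zero_add, hγ₀ t ht])
  have hκ₀ : IsElementaryRelation (Finsupp.single (⟨Z, hZ, ω, h, κ₀⟩ : PeriodSymbol) 1) :=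
    isElementaryRelation_single_of_const hZ ω h κ₀ (γ₀.toFun 0) fun _ _ => rfl
  have hκ₁ : IsElementaryRelation (Finsupp.single (⟨Z, hZ, ω, h, κ₁⟩ : PeriodSymbol) 1) :=
    isElementaryRelation_single_of_const hZ ω h κ₁ (γ₀.toFun 1) fun _ _ => rfl
  obtain ⟨k, ρ, a, hρ, ha, he⟩ := span_sub (span_sub (span_add (span_of_rel hκ₀)
    (span_of_rel hκ₁)) (span_of_rel hb₁)) (span_of_rel hb₂)
  exact ⟨k, ρ, a, hρ, ha, by rw [← he]; abel⟩

/-- **Homotopic paths have the same symbol**, version for a homotopy `C¹` on all of `ℝ²` (the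
common case of an explicit formula). [cite: HuberWustholz2022, §3.3.1 (pp. 42–43)] -/
theorem span_single_sub_single_of_homotopy_contDiff {Z : CurveData} (hZ : Z.IsSmoothAffineCurve)
    (ω : Fin Z.n → MvPolynomial (Fin Z.n) ℂ) (h : ∀ i, HasAlgCoeffs (ω i))
    (H : ℝ × ℝ → (Fin Z.n → ℂ)) (hH : ContDiff ℝ 1 H) (hmem : ∀ q, H q ∈ Z.points)
    (h0 : ∀ s, H (s, 0) = H (0, 0)) (h1 : ∀ s, H (s, 1) = H (0, 1))
    (γ₀ γ₁ : CurvePath Z) (hγ₀ : ∀ t ∈ Icc (0 : ℝ) 1, γ₀.toFun t = H (0, t))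
    (hγ₁ : ∀ t ∈ Icc (0 : ℝ) 1, γ₁.toFun t = H (1, t)) :
    InSpan (Finsupp.single (⟨Z, hZ, ω, h, γ₀⟩ : PeriodSymbol) (1 : ℂ) -
      Finsupp.single (⟨Z, hZ, ω, h, γ₁⟩ : PeriodSymbol) (1 : ℂ)) :=
  span_single_sub_single_of_homotopy hZ ω h H hH.contDiffOn (fun q _ => hmem q) (fun s _ => h0 s)
    (fun s _ => h1 s) γ₀ γ₁ hγ₀ hγ₁

/-- **Freely homotopic closed paths have the same symbol.** Let `H` be `C¹` on the closed unit
square with values in `Z`, with `H(s, 0) = H(s, 1)` for all `s` (a family of closed paths whose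
base point `α(s) = H(s, 0)` moves), `H(0, 0)` and `H(1, 0)` algebraic points, and let `γ₀`, `γ₁`
be paths agreeing with `H(0, ·)`, `H(1, ·)` on `[0,1]`. Then `(Z, ω, γ₀) − (Z, ω, γ₁)` lies in the
span of the elementary relations (the boundary of the square is `α + γ₁ − α − γ₀`; two triangles
(R5) and the reversal relation `α + α⁻ ∼ 0`). In homology: conjugate loops are homologous.
[cite: HuberWustholz2022, §3.3.1 (pp. 42–43)] -/
theorem span_single_sub_single_of_loopHomotopy {Z : CurveData} (hZ : Z.IsSmoothAffineCurve)
    (ω : Fin Z.n → MvPolynomial (Fin Z.n) ℂ) (h : ∀ i, HasAlgCoeffs (ω i))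
    (H : ℝ × ℝ → (Fin Z.n → ℂ)) (hH : ContDiffOn ℝ 1 H (Icc (0 : ℝ) 1 ×ˢ Icc (0 : ℝ) 1))
    (hmem : ∀ q ∈ Icc (0 : ℝ) 1 ×ˢ Icc (0 : ℝ) 1, H q ∈ Z.points)
    (hloop : ∀ s ∈ Icc (0 : ℝ) 1, H (s, 1) = H (s, 0))
    (hA0 : ∀ i, IsAlgebraic ℚ (H (0, 0) i)) (hA1 : ∀ i, IsAlgebraic ℚ (H (1, 0) i))
    (γ₀ γ₁ : CurvePath Z) (hγ₀ : ∀ t ∈ Icc (0 : ℝ) 1, γ₀.toFun t = H (0, t))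
    (hγ₁ : ∀ t ∈ Icc (0 : ℝ) 1, γ₁.toFun t = H (1, t)) :
    InSpan (Finsupp.single (⟨Z, hZ, ω, h, γ₀⟩ : PeriodSymbol) (1 : ℂ) -
      Finsupp.single (⟨Z, hZ, ω, h, γ₁⟩ : PeriodSymbol) (1 : ℂ)) := by
  have h0I : (0 : ℝ) ∈ Icc (0 : ℝ) 1 := ⟨le_rfl, zero_le_one⟩
  have h1I : (1 : ℝ) ∈ Icc (0 : ℝ) 1 := ⟨zero_le_one, le_rfl⟩
  have hbot : ∀ s ∈ Icc (0 : ℝ) 1, (s, (0 : ℝ)) ∈ Icc (0 : ℝ) 1 ×ˢ Icc (0 : ℝ) 1 :=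
    fun s hs => ⟨hs, h0I⟩
  -- the base-point path `α(s) = H(s, 0)`, its reverse, and the diagonal
  let α : CurvePath Z :=
    { toFun := fun s => H (s, 0)
      contDiffOn := hH.comp (contDiff_id.prodMk contDiff_const).contDiffOn fun s hs => hbot s hs
      mem_points := fun s hs => hmem _ (hbot s hs)
      algebraic_zero := hA0
      algebraic_one := hA1 }
  let αr : CurvePath Z :=
    { toFun := fun s => H (1 - s, 0)
      contDiffOn := hH.comp ((contDiff_const.sub contDiff_id).prodMk contDiff_const).contDiffOn
        fun s hs => hbot (1 - s) (one_sub_mem_Icc hs)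
      mem_points := fun s hs => hmem _ (hbot (1 - s) (one_sub_mem_Icc hs))
      algebraic_zero := fun i => by
        show IsAlgebraic ℚ (H (1 - 0, 0) i)
        rw [sub_zero]
        exact hA1 i
      algebraic_one := fun i => by
        show IsAlgebraic ℚ (H (1 - 1, 0) i)
        rw [sub_self]
        exact hA0 i }
  let δ : CurvePath Z :=
    { toFun := fun t => H (t, t)
      contDiffOn := hH.comp (contDiff_id.prodMk contDiff_id).contDiffOn fun t ht => mk_mem_prod ht ht
      mem_points := fun t ht => hmem _ (mk_mem_prod ht ht)
      algebraic_zero := hA0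
      algebraic_one := fun i => by
        show IsAlgebraic ℚ (H (1, 1) i)
        rw [hloop 1 h1I]
        exact hA1 i }
  -- the two triangles
  have hτ₁ : ContDiffOn ℝ 1 (fun q : ℝ × ℝ => H (q.1 + q.2, q.2)) stdTriangle :=
    hH.comp ((contDiff_fst.add contDiff_snd).prodMk contDiff_snd).contDiffOn
      fun q hq => add_mem_square_of_mem_stdTriangle hq
  have hτ₂ : ContDiffOn ℝ 1 (fun q : ℝ × ℝ => H (q.1, q.1 + q.2)) stdTriangle :=
    hH.comp (contDiff_fst.prodMk (contDiff_fst.add contDiff_snd)).contDiffOn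
      fun q hq => mem_square_add_of_mem_stdTriangle hq
  have hb₁ := IsElementaryRelation.boundary Z hZ ω h (fun q : ℝ × ℝ => H (q.1 + q.2, q.2)) hτ₁
    (fun q hq => hmem _ (add_mem_square_of_mem_stdTriangle hq)) α γ₁ δ
    (fun t _ => by show H (t, 0) = H (t + 0, 0); rw [add_zero])
    (fun t ht => by show γ₁.toFun t = H (1 - t + t, t); rw [sub_add_cancel, hγ₁ t ht])
    (fun t _ => by show H (t, t) = H (0 + t, t); rw [zero_add])
  have hb₂ := IsElementaryRelation.boundary Z hZ ω h (fun q : ℝ × ℝ => H (q.1, q.1 + q.2)) hτ₂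
    (fun q hq => hmem _ (mem_square_add_of_mem_stdTriangle hq)) δ αr γ₀
    (fun t _ => by show H (t, t) = H (t, t + 0); rw [add_zero])
    (fun t ht => by
      show H (1 - t, 0) = H (1 - t, 1 - t + t)
      rw [sub_add_cancel, hloop (1 - t) (one_sub_mem_Icc ht)])
    (fun t ht => by show γ₀.toFun t = H (0, 0 + t); rw [zero_add, hγ₀ t ht])
  -- `α + α⁻ ∼ 0`
  obtain ⟨ρ₁, ρ₂, hρ₁, hρ₂, hrev⟩ := exists_isElementaryRelation_add_reverse hZ ω h α αr fun _ _ => rfl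
  obtain ⟨k, ρ, a, hρ, ha, he⟩ := span_sub (span_sub (span_add (span_of_rel hρ₁) (span_of_rel hρ₂))
    (span_of_rel hb₁)) (span_of_rel hb₂)
  refine ⟨k, ρ, a, hρ, ha, ?_⟩
  rw [← he, ← hrev]
  abel

end CurvePeriods

end Literature.NumberTheory.Transcendental

end
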